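import Mathlib.Tactic.NormNum
import Mathlib.Tactic.DeriveFintype
import Mathlib.Data.List.Count

/-!
# Router-word score, part 3: the A10 SHADOW FOLDS (α)/(β) as total functions — the treatment text
# of record, kernel-stated before the hold-out data it will be evaluated on

Venture CertifiedManyBodySolver, cell `pub/hubbard-downfold`, seat hubbard-downfold-score-2 (session g4);
namespace `Summit.Ventures.CertifiedManyBodySolver.Downfold.RouterShadow`. Everything here is PROVED and
finite; nothing is about a material.

WHAT THIS IS NOT: not a router, not the shadow writer of record (`router/router.py` r17 2d90bb59b9ebbdca
is, PREREG Y45; second reading `validation/score/router/shadow_check.py`), not a score of record (shadow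
words never enter R), and not physics. It is the kernel reference for PREREG Y44 — the A10 treatment text
ruled by the cell lead (RULING (B) 2026-08-26T22:06:57Z, RULING A10-FOLDS 22:17:57Z) on score-2's mechanical
readings (INBOX 21:48:33Z) of the two candidate treatments logged for the post-D4 review of the frozen
router's `UND:MIXED` words («(α) per-school r₁ with a majority rule, (β) an INFL-Uschool tag … when only one
school crosses», HgBa2CuO4.md §OF-RECORD v1.2):

* `classOf` — the R3a verdict CLASS of one admissible U school from its own outward r₁ = [lo, hi]:
  `BH1` if θ_hi ≤ lo, `WEAK` if hi < θ_lo, `MIXED` otherwise (half-open reading; thresholds of record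
  θ_lo = 1/4, θ_hi = 3/5).
* `strictMajority` — (α): the class held by a STRICT majority (> half) of the listed schools, `none` on a
  tie and `none` for a single school (its hull is the frozen hull) ⇒ (α) = the frozen word.
* `betaFires` — (β) fires iff the frozen primary is `UND:MIXED` AND exactly ONE listed school is low
  (`MIXED` or `WEAK`) AND at least one listed school is `BH1`; otherwise (β) = the frozen word.

The lead's EXPECTED PRINTS for the writer's selftest (A10-FOLDS) are theorems by `decide`
(`slco_alpha`, `slco_beta`, `ncco_*`, `threeSchools_*`, `twoLow_*`), and the consequence score-2 stated when
registering the protocol (PREREG Y42: «with two-school hulls (α) ≡ frozen») is `strictMajority_pair`: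
two schools never yield a strict majority unless they agree, while `betaFires_pair` says (β) fires on a
two-school cell exactly when one school is `BH1` and the other is not.
-/

namespace Summit.Ventures.CertifiedManyBodySolver.Downfold

namespace RouterShadow

/-- The R3a verdict class of ONE admissible U school read on its own r₁ member (ROUTER §3 R3a applied
per school): strong-coupling one-band (`BH1`), weak-coupling corner (`WEAK`), or the straddling band
(`MIXED`). [folklore] -/
inductive SchoolClass
  | BH1
  | WEAK
  | MIXED
  deriving DecidableEq, Repr, Fintype

/-- The two R3a thresholds (θ_lo, θ_hi) as exact rationals. [folklore] -/
structure Thresholds where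
  /-- lower edge of the mixed band (r₁_hi < θ_lo ⇒ WEAK) -/
  θlo : ℚ
  /-- upper edge of the mixed band (θ_hi ≤ r₁_lo ⇒ BH1) -/
  θhi : ℚ

/-- ROUTER v0.6.x thresholds of record: θ_lo = 0.25, θ_hi = 0.6 (A1-i). [folklore] -/
def thresholdsOfRecord : Thresholds := ⟨1 / 4, 3 / 5⟩

/-- R3a verdict class of a school whose outward r₁ member is the interval [lo, hi] (half-open reading of
record: r₁_lo = θ_hi exactly ⇒ `BH1`; r₁_hi = θ_lo exactly ⇒ `MIXED`). [folklore] -/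
def classOf (T : Thresholds) (lo hi : ℚ) : SchoolClass :=
  if T.θhi ≤ lo then .BH1 else if hi < T.θlo then .WEAK else .MIXED

/-- Number of LOW schools (class `MIXED` or `WEAK`) in a list of per-school classes. [folklore] -/
def lowCount (l : List SchoolClass) : ℕ := l.count .MIXED + l.count .WEAK

/-- (α) STRICT MAJORITY CLASS: `some c` iff more than half of the listed schools (and at least two are
listed) have class `c`; `none` on a tie, for a single school, and for no school — in all `none` cases the
(α) shadow word is the FROZEN word (lead RULING A10-FOLDS: «no strict majority ⇒ frozen; tie or single
school ⇒ frozen»). [folklore] -/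
def strictMajority (l : List SchoolClass) : Option SchoolClass :=
  if l.length < 2 then none
  else if l.length < 2 * l.count .BH1 then some .BH1
  else if l.length < 2 * l.count .MIXED then some .MIXED
  else if l.length < 2 * l.count .WEAK then some .WEAK
  else none

/-- (β) FIRING PREDICATE: the INFL-Uschool treatment re-routes on the `BH1`-class schools' joint hull iff the
frozen primary is `UND:MIXED` (`frozenMixed = true`) AND exactly one listed school is low AND at least one
listed school is `BH1`; otherwise the (β) shadow word is the frozen word (lead RULING A10-FOLDS; «single-school
hull ⇒ frozen; two low schools ⇒ frozen»). [folklore] -/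
def betaFires (frozenMixed : Bool) (l : List SchoolClass) : Bool :=
  frozenMixed && (lowCount l == 1) && decide (1 ≤ l.count .BH1)

/-! ## The writer's selftest cases = the lead's expected prints (A10-FOLDS 22:17:57Z; router.py r17 5/5) -/

/-- SLCO #37 (and Hg1201-like): two schools, cRPA@LDA `MIXED` vs MACE `BH1` ⇒ (α) no strict majority ⇒
frozen. [folklore] -/
theorem slco_alpha : strictMajority [.MIXED, .BH1] = none := by decide

/-- SLCO #37: frozen primary `UND:MIXED`, exactly one low school, one `BH1` school ⇒ (β) fires
(printed «1BH+3BE [INFL-Uschool(cRPA@LDA …)]»). [folklore] -/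
theorem slco_beta : betaFires true [.MIXED, .BH1] = true := by decide

/-- NCCO #20: a single school (cRPA@LDA, `MIXED`) ⇒ (α) frozen. [folklore] -/
theorem ncco_alpha : strictMajority [.MIXED] = none := by decide

/-- NCCO #20: a single low school and no `BH1` school ⇒ (β) does not fire ⇒ frozen. [folklore] -/
theorem ncco_beta : betaFires true [.MIXED] = false := by decide

/-- Three schools, two `BH1` and one `MIXED` ⇒ (α) strict majority `BH1` (printed «1BH+3BE»). [folklore] -/
theorem threeSchools_alpha : strictMajority [.MIXED, .BH1, .BH1] = some .BH1 := by decide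

/-- Three schools, two `BH1` and one `MIXED`, frozen `UND:MIXED` ⇒ (β) fires. [folklore] -/
theorem threeSchools_beta : betaFires true [.MIXED, .BH1, .BH1] = true := by decide

/-- Three schools, two low ⇒ (α) strict majority `MIXED` (printed «UND:MIXED…»). [folklore] -/
theorem twoLow_alpha : strictMajority [.MIXED, .MIXED, .BH1] = some .MIXED := by decide

/-- Three schools, two low ⇒ (β) does not fire («two low schools ⇒ frozen»). [folklore] -/
theorem twoLow_beta : betaFires true [.MIXED, .MIXED, .BH1] = false := by decide

/-- The SLCO per-school readings of record (desc-SrLaCuO2-P0.json 73a36b2c49e38505, outward):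
cRPA@LDA r₁ = [0.275, 0.351] is `MIXED`, MACE r₁ = [0.995, 1.174] is `BH1`, under the thresholds of
record. [folklore] -/
theorem slco_classes :
    classOf thresholdsOfRecord (275 / 1000) (351 / 1000) = .MIXED ∧
      classOf thresholdsOfRecord (995 / 1000) (1174 / 1000) = .BH1 := by
  refine ⟨?_, ?_⟩ <;> simp [classOf, thresholdsOfRecord] <;> norm_num

/-! ## Structural facts stated with the protocol (PREREG Y42/Y44) -/

/-- No school listed ⇒ (α) frozen. [folklore] -/
theorem strictMajority_nil : strictMajority [] = none := by decide

/-- A single school is never a strict majority in the ruled sense (its hull IS the frozen hull) ⇒ (α)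
frozen. [folklore] -/
theorem strictMajority_singleton (c : SchoolClass) : strictMajority [c] = none := by
  cases c <;> decide

/-- TWO SCHOOLS: (α) decides only if they agree — a 1:1 split is a tie ⇒ frozen. This is the consequence
score-2 registered with the protocol: on two-school hulls (α) ≡ frozen wherever the schools disagree, so (α)
can only win the P-A10.5 count on cells listing ≥ 3 schools. [folklore] -/
theorem strictMajority_pair (a b : SchoolClass) :
    strictMajority [a, b] = if a = b then some a else none := by
  cases a <;> cases b <;> decide

/-- TWO SCHOOLS: (β) fires (given a frozen `UND:MIXED` primary) exactly when one school is `BH1` and the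
other is not. [folklore] -/
theorem betaFires_pair (a b : SchoolClass) :
    betaFires true [a, b] = decide ((a = .BH1 ∧ b ≠ .BH1) ∨ (b = .BH1 ∧ a ≠ .BH1)) := by
  cases a <;> cases b <;> decide

/-- (β) never fires unless the frozen primary is `UND:MIXED` (the hull straddles). [folklore] -/
theorem betaFires_of_not_mixed (l : List SchoolClass) : betaFires false l = false := by
  simp [betaFires]

/-- (β) never fires on a single-school cell («single-school hull ⇒ frozen»). [folklore] -/
theorem betaFires_singleton (b : Bool) (c : SchoolClass) : betaFires b [c] = false := by
  cases b <;> cases c <;> decide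

/-- (β) is insensitive to the ORDER in which the schools are listed (it reads counts only). [folklore] -/
theorem betaFires_perm {l l' : List SchoolClass} (h : l.Perm l') (b : Bool) :
    betaFires b l = betaFires b l' := by
  simp only [betaFires, lowCount, h.count_eq]

/-- (α) is insensitive to the ORDER in which the schools are listed (it reads counts and the length only).
[folklore] -/
theorem strictMajority_perm {l l' : List SchoolClass} (h : l.Perm l') :
    strictMajority l = strictMajority l' := by
  simp only [strictMajority, h.count_eq, h.length_eq]

/-- Two distinct classes together occupy at most the whole list. [folklore] -/
theorem count_add_count_le_length {c d : SchoolClass} (hcd : c ≠ d) :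
    ∀ l : List SchoolClass, l.count c + l.count d ≤ l.length
  | [] => by simp
  | x :: xs => by
      have ih := count_add_count_le_length hcd xs
      rw [List.count_cons, List.count_cons, List.length_cons]
      by_cases hxc : x = c
      · subst hxc
        have h2 : (x == d) = false := by simpa [beq_eq_false_iff_ne] using hcd
        simp only [beq_self_eq_true, ↓reduceIte, h2, Bool.false_eq_true]
        omega
      · have h1 : (x == c) = false := by simpa [beq_eq_false_iff_ne] using hxc
        by_cases hxd : x = d
        · subst hxd
          simp only [h1, beq_self_eq_true, ↓reduceIte, Bool.false_eq_true]
          omega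
        · have h2 : (x == d) = false := by simpa [beq_eq_false_iff_ne] using hxd
          simp only [h1, h2, Bool.false_eq_true, ↓reduceIte]
          omega

/-- At most one class can be held by a strict majority: if two distinct classes both exceeded half the
list, their counts alone would exceed its length. Hence the check order inside `strictMajority` is
immaterial. [folklore] -/
theorem not_two_strict_majorities (l : List SchoolClass) {c d : SchoolClass} (hcd : c ≠ d)
    (hc : l.length < 2 * l.count c) (hd : l.length < 2 * l.count d) : False := by
  have := count_add_count_le_length hcd l
  omega

end RouterShadow

end Summit.Ventures.CertifiedManyBodySolver.Downfold

/-! ## §3 No-regression coverage (score-2 g6, 2026-08-27): on which cells CAN a shadow word differ from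
the frozen word?  Only on cells whose frozen primary is `UND:MIXED` and whose school list has EXACTLY one
low member and at least one `BH1` member ((β)), or a strict non-frozen majority ((α)).  A cell worded `1BH`
by a hull with θ_hi ≤ r₁_lo has every member `BH1` (members sit inside the hull), so (α) returns `BH1` = the
frozen class and (β) cannot fire; a single-school cell and a cell with two or more low schools are frozen
under (β) as well.  Consequence for the protocol's bookkeeping: the «owed» shadow rows on such cells are
provably trivial (shadow = frozen) — harmless to write, unnecessary for the soundness of the no-regression
clause.  Instances: Hg-1223 #35 @0 (four school entries, two low: (α) tie, (β) silent — and its primary is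
`UND:MIXED` by the w_d clause anyway) and Hg1201 #19 (one low, three `BH1`: (α) = `BH1`, (β) fires). -/

namespace Summit.Ventures.CertifiedManyBodySolver.Downfold

namespace RouterShadow

/-- (β) is silent unless EXACTLY one listed school is low. [folklore] -/
theorem betaFires_of_lowCount_ne_one (b : Bool) (l : List SchoolClass) (h : lowCount l ≠ 1) :
    betaFires b l = false := by
  have h' : (lowCount l == 1) = false := by simpa [beq_eq_false_iff_ne] using h
  simp [betaFires, h']

/-- A list of schools that are all `BH1` has no low member. [folklore] -/
theorem lowCount_eq_zero_of_forall_BH1 : ∀ (l : List SchoolClass), (∀ c ∈ l, c = .BH1) → lowCount l = 0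
  | [], _ => by simp [lowCount]
  | x :: xs, h => by
      have hx : x = .BH1 := h x (by simp)
      have ih := lowCount_eq_zero_of_forall_BH1 xs (fun c hc => h c (by simp [hc]))
      subst hx
      simp only [lowCount, List.count_cons] at ih ⊢
      simpa using ih

/-- NO REGRESSION ON A `1BH` CELL, (β) half: when every listed school is `BH1` the INFL-Uschool treatment
cannot fire, whatever the frozen primary. [folklore] -/
theorem betaFires_of_forall_BH1 (b : Bool) (l : List SchoolClass) (h : ∀ c ∈ l, c = .BH1) :
    betaFires b l = false :=
  betaFires_of_lowCount_ne_one b l (by rw [lowCount_eq_zero_of_forall_BH1 l h]; decide)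

/-- all-`BH1` lists count their whole length as `BH1`. [folklore] -/
theorem count_BH1_eq_length_of_forall_BH1 : ∀ (l : List SchoolClass), (∀ c ∈ l, c = .BH1) →
    l.count .BH1 = l.length
  | [], _ => by simp
  | x :: xs, h => by
      have hx : x = .BH1 := h x (by simp)
      have ih := count_BH1_eq_length_of_forall_BH1 xs (fun c hc => h c (by simp [hc]))
      subst hx
      simp [ih]

/-- NO REGRESSION ON A `1BH` CELL, (α) half: two or more schools, all `BH1` ⇒ the strict-majority class is
`BH1` — the frozen class — so the (α) word equals the frozen word. [folklore] -/
theorem strictMajority_of_forall_BH1 (l : List SchoolClass) (h2 : 2 ≤ l.length)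
    (h : ∀ c ∈ l, c = .BH1) : strictMajority l = some .BH1 := by
  have hc := count_BH1_eq_length_of_forall_BH1 l h
  have hlt : ¬ l.length < 2 := Nat.not_lt.mpr h2
  have hmaj : l.length < 2 * l.count .BH1 := by rw [hc]; omega
  simp [strictMajority, hlt, hmaj]

/-- MEMBERS SIT INSIDE THE HULL: a school whose r₁ member lies above the hull's lower edge is `BH1` as soon
as the hull itself is (θ_hi ≤ hull_lo ≤ lo) — the reason a cell worded `1BH` on its across-school hull has
only `BH1` schools. [folklore] -/
theorem classOf_eq_BH1_of_hull (T : Thresholds) {hullLo lo hi : ℚ} (hhull : T.θhi ≤ hullLo)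
    (hmem : hullLo ≤ lo) : classOf T lo hi = .BH1 := by
  simp [classOf, le_trans hhull hmem]

/-- Hg-1223 #35 @0 as printed by the writer (router.py r28 `--shadow`, 2026-08-27T02:4xZ, two sites × two
schools: cRPA@LDA `MIXED` / MACE GGA+cRPA `BH1` on Cu-OP and on Cu-IP): (α) 2 : 2 tie ⇒ frozen; (β) two low
schools ⇒ silent ⇒ frozen.  (Its primary is `UND:MIXED` by the w_d_FS clause in any case — PREREG Y47.)
[folklore] -/
theorem hg1223_P0_shadow :
    strictMajority [.MIXED, .BH1, .MIXED, .BH1] = none ∧ betaFires true [.MIXED, .BH1, .MIXED, .BH1] = false := by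
  decide

/-- Hg1201 #19 @0 (descriptor of record 82c150d455adba3a: cRPA@LDA `MIXED`; MACE, cGW+LRFB, cGW all `BH1`):
(α) strict majority `BH1` (3 of 4) and (β) fires (exactly one low) — both shadow words read «1BH+3BE»
(SHADOW-A10.tsv rows 3–4). [folklore] -/
theorem hg1201_P0_shadow :
    strictMajority [.MIXED, .BH1, .BH1, .BH1] = some .BH1 ∧ betaFires true [.MIXED, .BH1, .BH1, .BH1] = true := by
  decide

/-! ## §5 PRE-REGISTERED prints for the two THREE-school / ONE-low records of 2026-08-27 (score-2 g8, written BEFORE the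
writer's r36 shadow rows on these records exist; `validation/score/PREREG.md` §E 05:0xZ; independent reading
`router/shadow_check.py`). Thresholds of record θ_lo = 1/4, θ_hi = 3/5; classes from the printed r₁ intervals. -/

/-- Tl-2201 #34 @0 (descriptor of record 5a28e481049a1950, lead WORDS 04:54:08Z «UND:MIXED+1BH+3BE+EPH»; hold-out Y37 cells
#34a/#34b/#34c): schools (S) Vučičević 2026 r₁ [0.532, 0.591] · (D) Nilsson r₁ [0.725, 0.805] · MACE proxy r₁ [0.895, 1.289]
⇒ classes MIXED · BH1 · BH1. [folklore] -/
theorem tl2201_P0_classes :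
    classOf thresholdsOfRecord (532 / 1000) (591 / 1000) = .MIXED ∧ classOf thresholdsOfRecord (725 / 1000) (805 / 1000) = .BH1 ∧
    classOf thresholdsOfRecord (895 / 1000) (1289 / 1000) = .BH1 := by
  refine ⟨?_, ?_, ?_⟩ <;> simp [classOf, thresholdsOfRecord] <;> norm_num

/-- … ⇒ PREDICTED prints: (α) strict majority `BH1` (2 of 3) ⇒ «1BH+3BE»; (β) fires (frozen primary UND:MIXED, exactly one low
school) ⇒ «1BH+3BE [INFL-Uschool((S) …)]» — both AGREE against [`1BH+3BE`] on the three Y37 cells. [folklore] -/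
theorem tl2201_P0_shadow_predicted :
    strictMajority [.MIXED, .BH1, .BH1] = some .BH1 ∧ betaFires true [.MIXED, .BH1, .BH1] = true := by decide

/-- SLCO #37 @0 RE-ISSUED with a third school (descriptor 1add4fbb4c08c2f5, lead R-af: CaCuO₂ VASP-cRPA = IL-class member):
Jang (W) r₁ [0.275, 0.351] · MACE CaCuO₂ r₁ [0.995, 1.174] · VASP-cRPA CaCuO₂ r₁ [0.754, 0.838] ⇒ classes MIXED · BH1 · BH1.
[folklore] -/
theorem slco_v3_classes :
    classOf thresholdsOfRecord (275 / 1000) (351 / 1000) = .MIXED ∧ classOf thresholdsOfRecord (995 / 1000) (1174 / 1000) = .BH1 ∧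
    classOf thresholdsOfRecord (754 / 1000) (838 / 1000) = .BH1 := by
  refine ⟨?_, ?_, ?_⟩ <;> simp [classOf, thresholdsOfRecord] <;> norm_num

/-- … ⇒ PREDICTED prints: (α) strict majority `BH1` ⇒ «1BH+3BE» — NO LONGER THE TIE of the two-school record
(`slco_alpha`: `strictMajority [.MIXED, .BH1] = none` ⇒ frozen ⇒ PARTIAL); (β) fires as before (`slco_beta`). The change in the
(α) reading comes from the record's school LIST (a lead ruling), not from the treatment text. [folklore] -/
theorem slco_v3_shadow_predicted :
    strictMajority [.MIXED, .BH1, .BH1] = some .BH1 ∧ strictMajority [.MIXED, .BH1] = none ∧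
    betaFires true [.MIXED, .BH1, .BH1] = true ∧ betaFires true [.MIXED, .BH1] = true := by decide

/-! ## §6 PRE-REGISTERED prints for the owed Hg1201 RE-STAMP with the in-house members (score-2 g9, PREREG Y76, written
2026-08-27T06:2xZ BEFORE run-1's revision / the writer's rows). Lead ACK 06:17:06Z admitted tool-1's one-band members U^(W) = 2.87 eV
(26 Ry) and U^(D) = 3.34 eV (20 Ry), interior to the hull. Their classes on the records of record (P0: W₁ [3.7, 4.4]; P10: W₁
[3.916, 5.06]) and the prints under the two SCHOOL-BINNING conventions now in use — (A) each in-house construction its own school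
(nickelate records), (B) one cRPA school (La-214 record, R-o/R-y letter). The lead's ruling on the convention decides which applies. -/

/-- In-house (W) 2.87 eV and (D) 3.34 eV as their own schools: r₁ = U / W₁. @0 (W₁ [3.7, 4.4]): (W) [287/440, 287/370] and
(D) [334/440, 334/370] are both `BH1`; @10 (W₁ [3.916, 5.06]): (W) [287/506, 2870/3916] STRADDLES θ_hi = 3/5 ⇒ `MIXED`, (D)
[334/506, 3340/3916] `BH1`. [folklore] -/
theorem hg1201_inhouse_classes :
    classOf thresholdsOfRecord (287 / 440) (287 / 370) = .BH1 ∧ classOf thresholdsOfRecord (334 / 440) (334 / 370) = .BH1 ∧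
    classOf thresholdsOfRecord (287 / 506) (2870 / 3916) = .MIXED ∧ classOf thresholdsOfRecord (334 / 506) (3340 / 3916) = .BH1 := by
  refine ⟨?_, ?_, ?_, ?_⟩ <;> simp [classOf, thresholdsOfRecord] <;> norm_num

/-- Convention (A), P = 0 (#19 @0, #19b @0): schools Jang `MIXED` · MACE · cGW+LRFB · cGW · in-house (W) · in-house (D) all `BH1`
⇒ (α) strict majority `BH1` (5 of 6) and (β) fires (exactly one low) — PREDICTED prints unchanged «1BH+3BE» (head-identical
re-stamps, no new SHADOW-A10 row). [folklore] -/
theorem hg1201_P0_restamp_predicted_A :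
    strictMajority [.MIXED, .BH1, .BH1, .BH1, .BH1, .BH1] = some .BH1 ∧
    betaFires true [.MIXED, .BH1, .BH1, .BH1, .BH1, .BH1] = true := by decide

/-- Convention (A), P = 10 GPa (#19 @10): Jang `MIXED` · MACE · cGW+LRFB · cGW `BH1` · in-house (W) `MIXED` · in-house (D) `BH1`
⇒ (α) strict majority `BH1` (4 of 6) ⇒ «1BH+3BE» unchanged, but (β) has TWO low schools ⇒ does NOT fire ⇒ frozen
«UND:MIXED+1BH+3BE+EPH» ⇒ PARTIAL — a REGRESSION against the current (β) row (AGREE) on a calibration cell, which P-A10.5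
reads as disqualifying (β). [folklore] -/
theorem hg1201_P10_restamp_predicted_A :
    strictMajority [.MIXED, .BH1, .BH1, .BH1, .MIXED, .BH1] = some .BH1 ∧
    betaFires true [.MIXED, .BH1, .BH1, .BH1, .MIXED, .BH1] = false := by decide

/-- Convention (B): Jang 2.15 ∪ ours 2.87/3.34 = ONE cRPA school with U [2.15, 3.34] ⇒ r₁ @0 [215/440, 334/370] and @10
[215/506, 3340/3916], both `MIXED` ⇒ school list `MIXED` · `BH1` ×3 as today ⇒ (α) `BH1` 3 of 4, (β) fires — NOTHING moves at any
column (`hg1201_P0_shadow`). [folklore] -/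
theorem hg1201_restamp_predicted_B :
    classOf thresholdsOfRecord (215 / 440) (334 / 370) = .MIXED ∧ classOf thresholdsOfRecord (215 / 506) (3340 / 3916) = .MIXED ∧
    strictMajority [.MIXED, .BH1, .BH1, .BH1] = some .BH1 ∧ betaFires true [.MIXED, .BH1, .BH1, .BH1] = true := by
  refine ⟨?_, ?_, by decide, by decide⟩ <;> simp [classOf, thresholdsOfRecord] <;> norm_num

end RouterShadow

end Summit.Ventures.CertifiedManyBodySolver.Downfold

/-! ## §7 THE LANDED R-az RE-STAMPS (score-2 g10, 2026-08-27T07:3xZ; `validation/score/PREREG.md` §C E32c, row Y80). Lead RULING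
R-az (2026-08-27T06:35:57Z: «school = LEVEL OF THEORY — S-I DFT+cRPA, S-II GW-level MACE family, S-III other») made every conformed
cuprate record a TWO-school list (S-I, S-II). The writer's rows of 07:29:46–50Z (`router/SHADOW-WORDS.tsv` cf72b8263056168a) print
(α) = FROZEN and (β) = «1BH+3BE…» on SLCO #37, the La-214 family ×8 and Hg1201 ×3 — the `slco_alpha` / `slco_beta` case on each
record, as Y80 registered before the rows existed. Below: the classes of the printed per-school r₁ intervals (records
desc-La2CuO4-P0 4b128cb2ed79acdf: S-I [0.535, 0.987], S-II [0.945, 1.352]; Hg1201 @0 e3eaa24e1e5d5f35: S-I [0.456, 0.905], S-II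
[0.762, 1.153]; Hg1201 @10 345e92d7b4875186: S-I [0.372, 0.895], S-II [0.621, 1.139]) and the two-school consequence. Under
convention (B) of §6 the earlier FOUR-school Hg1201 list predicted «nothing moves»; R-az merged cGW / cGW+LRFB / MACE into ONE
S-II school, so the list of record is the pair, and the pair ties under (α). -/

namespace Summit.Ventures.CertifiedManyBodySolver.Downfold

namespace RouterShadow

/-- La₂CuO₄ family record after R-az: S-I DFT+cRPA r₁ [0.535, 0.987] STRADDLES θ_hi = 3/5 ⇒ `MIXED`; S-II MACE family
[0.945, 1.352] ⇒ `BH1`. [folklore] -/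
theorem raz_la214_classes :
    classOf thresholdsOfRecord (535 / 1000) (987 / 1000) = .MIXED ∧
    classOf thresholdsOfRecord (945 / 1000) (1352 / 1000) = .BH1 := by
  refine ⟨?_, ?_⟩ <;> simp [classOf, thresholdsOfRecord] <;> norm_num

/-- Hg1201 records after R-az: @0 S-I [0.456, 0.905] `MIXED`, S-II [0.762, 1.153] `BH1`; @10 GPa S-I [0.372, 0.895] `MIXED`,
S-II [0.621, 1.139] `BH1` (0.621 ≥ 3/5 — the GW-level school clears θ_hi at 10 GPa by 0.021). [folklore] -/
theorem raz_hg1201_classes :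
    classOf thresholdsOfRecord (456 / 1000) (905 / 1000) = .MIXED ∧ classOf thresholdsOfRecord (762 / 1000) (1153 / 1000) = .BH1 ∧
    classOf thresholdsOfRecord (372 / 1000) (895 / 1000) = .MIXED ∧ classOf thresholdsOfRecord (621 / 1000) (1139 / 1000) = .BH1 := by
  refine ⟨?_, ?_, ?_, ?_⟩ <;> simp [classOf, thresholdsOfRecord] <;> norm_num

/-- THE LANDED PRINT on every conformed cuprate record (school list [S-I `MIXED`, S-II `BH1`], frozen primary `UND:MIXED`):
(α) no strict majority ⇒ FROZEN word ⇒ PARTIAL as before; (β) exactly one low school beside a `BH1` school ⇒ FIRES ⇒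
«1BH+3BE…» ⇒ AGREE. Twelve (α) rows of 2026-08-27T07:29Z read exactly this; it is `slco_alpha`/`slco_beta` again, in either
listing order. [folklore] -/
theorem raz_pair_shadow :
    strictMajority [.MIXED, .BH1] = none ∧ betaFires true [.MIXED, .BH1] = true ∧
    strictMajority [.BH1, .MIXED] = none ∧ betaFires true [.BH1, .MIXED] = true := by decide

/-- The P-A10.5 reading this leaves on the tracker (PREREG Y42/Y44; `RouterScoreAggregate.recommend` takes the margins): with every
Y37 cell that carries shadow rows a two-school [`MIXED`, `BH1`] record, (α) changes NO cell (margin 0 — does not qualify) while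
(β) flips each such cell PARTIAL → AGREE (margin = their number, 4 on the current rows; 0 regressions). Stated here as the
per-cell fact: on such a record (α) keeps the frozen outcome and (β) does not. [folklore] -/
theorem raz_pair_margin_contribution :
    (strictMajority [.MIXED, .BH1]).isNone = true ∧ betaFires true [.MIXED, .BH1] = true := by decide

end RouterShadow

end Summit.Ventures.CertifiedManyBodySolver.Downfold
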